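import Literature.Probability.LatticeModels.SahiThirdOrderCorrelation
import Mathlib.Algebra.Order.BigOperators.Group.Finset
import Mathlib.Tactic.Linarith
import Mathlib.Tactic.Ring
import HarnessLib
import HarnessLib.Audit

/-!
# `NoHeavyLowerTail` (crux stmt-CriticalPhenomena-4575), Sahi programme P4 (monotone coupling / transport):
# Sahi's `C₃` in TRANSPORT FORM — an upward flow with divergence bounded by the first-slot density proves `E₃ ≥ 0`

Support file (cell `prim-l12`, seat P4 "Holley / monotone coupling"; `--supports stmt-CriticalPhenomena-4575`).
No named facts, no sorries; two `def … : Prop` CONJECTURE statements (clearly marked, never to be used as facts).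

SETTING.  A finite preorder `α` with a weight `μ : α → ℝ` (total mass `Z = mass μ univ`); `latticeE3 μ A B C`
(`Literature.Probability.LatticeModels.latticeE3`, `= Z³·E₃`) is Sahi's third functional on three finite sets.
`E₃` is LINEAR in each slot: `latticeE3 μ U A B = Σ_{z ∈ U} μ z · density μ A B z` (`latticeE3_eq_sum_density`) with the
first-slot density
  `density μ A B z = 2Z²·1_{A∩B}(z) + m(A)m(B) − Z·m(A∩B) − Z·m(A)·1_B(z) − Z·m(B)·1_A(z)`,
i.e. (for `Z = 1`, `a = m(A)`, `b = m(B)`, `m = m(A∩B)`, `Cov = m − ab`):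
  `+((1−a) + (1−b) − Cov)` on `A ∩ B` (CAPACITY),  `−(b + Cov)` on `A ∖ B`, `−(a + Cov)` on `B ∖ A`, `−Cov` off `A ∪ B` (SUPPLY).
So "`E₃(U,A,B) ≥ 0` for every up-set `U`" says: every up-set carries at least as much capacity as supply — the HALL /
cut condition of an upward transportation problem.  By max-flow–min-cut (Strassen's theorem on the finite poset) this is
EQUIVALENT to the existence of an upward flow moving the supply `a·μ|_{B∖A} + b·μ|_{A∖B} + Cov·μ|_{(A∩B)ᶜ}` into `A ∩ B`
within the capacity `((1−a)+(1−b)−Cov)·μ|_{A∩B}` — a MONOTONE COUPLING statement ("Holley/Strassen form of `C₃`").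

PROVED HERE (the sound direction, all that a proof of `C₃` by coupling needs):
* `sum_upperSet_nonneg_of_upFlow` — if an upward flow `f ≥ 0` (supported on pairs `y ≤ x`) has net inflow
  `(Σ_y f y z) − (Σ_x f z x) ≤ w z` at every point, then `Σ_{z∈U} w z ≥ 0` for every up-set `U` (nothing flows out of an up-set);
* `latticeE3_eq_sum_density` — the first-slot linearity identity above;
* `latticeE3_nonneg_of_hasC3Flow` — a `C₃`-flow for the pair `(A,B)` gives `latticeE3 μ U A B ≥ 0` for every up-set `U`;
  `latticeE3_nonneg_of_forall_hasC3Flow` — flows for all up-set pairs give `E₃ ≥ 0` on all up-set triples.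
STATED HERE (conjectures = the coupling form of Sahi's `C₃` / Kahn's Conjecture 5; equivalent to them by Strassen, whose
hard direction is not formalised): `C3FlowFormFKG` (every FKG weight on a finite distributive lattice) — it implies
`latticeE3 ≥ 0` on up-set triples (`latticeE3_nonneg_of_c3FlowFormFKG`), i.e. the indicator form of `SahiConjecture 3`.
CENSUS (seat P4, exact rational max-flow, this session): the flow exists for EVERY pair of up-sets of `{0,1}^k`, `k ≤ 4`
(171 unordered pairs at `k = 3` under 8 product weights: uniform 1/2, 1/3, 1/10, 9/10, one mixed, 3 random; 13 861 pairs at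
`k = 4` under 5 weights: uniform 1/2, 9/10, mixed, 2 random) — as it must, `C₃` being certified on `{0,1}^k`, `k ≤ 5`
(`…SahiC3CubeFour`, prim-sahi CENSUS.md §1); structural finding: in the same range the flow can ALWAYS be chosen so that the
COVARIANCE mass `Cov·μ|_{(A∩B)ᶜ}` moves only to MINIMAL elements of `A ∩ B` above its source while the Harris masses
`a·μ|_{B∖A}`, `b·μ|_{A∖B}` spread ("R7": 0 infeasible / 171 × 8 at `k = 3`, 0 / 13 861 × 5 at `k = 4`); plain
minterm insertion for all the mass is infeasible already at `k = 3` (pair `X₁`, `X₂∨X₃`), and so is the conditional push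
`y ↦ μ(· | target ∩ [y))` (pair `X₁`, `X₁∨X₂∨X₃`).  [this work; equality structure (Z) of prim-sahi CENSUS.md §1 respected:
for an independent pair the flow is forced = the Harris transport of the other block]
-/

namespace Summit.CriticalPhenomena.PercolationContinuityZ3.Theorems.C3Transport

open Finset Literature.Probability.LatticeModels

variable {α : Type*} [Fintype α]

/-! ### Upward flows and the cut inequality -/

/-- An UPWARD FLOW on a preorder: a nonnegative kernel supported on pairs `y ≤ x` (`f y x` = mass moved from `y` up to `x`).
[folklore] -/
structure IsUpFlow [Preorder α] (f : α → α → ℝ) : Prop where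
  /-- flows are nonnegative -/
  nonneg : ∀ y x, 0 ≤ f y x
  /-- mass only moves upward -/
  le_of_ne_zero : ∀ y x, f y x ≠ 0 → y ≤ x

/-- Net inflow (divergence) of a kernel at a point: `(Σ_y f y z) − (Σ_x f z x)`. [folklore] -/
def netInflow (f : α → α → ℝ) (z : α) : ℝ := (∑ y, f y z) - ∑ x, f z x

/-- **Nothing flows out of an up-set.**  If an upward flow has net inflow at most `w z` at every point `z`, then
`Σ_{z ∈ U} w z ≥ 0` for every up-set `U` (the easy direction of max-flow–min-cut / Strassen on a finite preorder). [folklore] -/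
theorem sum_upperSet_nonneg_of_upFlow [Preorder α] [DecidableEq α] {f : α → α → ℝ} (hf : IsUpFlow f)
    {w : α → ℝ} (hw : ∀ z, netInflow f z ≤ w z) {U : Finset α} (hU : IsUpperSet (U : Set α)) :
    0 ≤ ∑ z ∈ U, w z := by
  -- mass leaving a point of `U` stays in `U`
  have h1 : ∑ z ∈ U, ∑ x, f z x = ∑ z ∈ U, ∑ x ∈ U, f z x := by
    refine Finset.sum_congr rfl fun z hz => ?_
    refine (Finset.sum_subset (Finset.subset_univ U) fun x _ hxU => ?_).symm
    by_contra h
    exact hxU (hU (hf.le_of_ne_zero z x h) (Finset.mem_coe.2 hz))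
  -- mass arriving at a point of `U` from inside `U` is part of all arriving mass
  have h2 : ∑ z ∈ U, ∑ y ∈ U, f y z ≤ ∑ z ∈ U, ∑ y, f y z :=
    Finset.sum_le_sum fun z _ => Finset.sum_le_univ_sum_of_nonneg fun y => hf.nonneg y z
  have h3 : ∑ z ∈ U, ∑ y ∈ U, f y z = ∑ z ∈ U, ∑ x ∈ U, f z x := Finset.sum_comm
  have h4 : ∑ z ∈ U, netInflow f z ≤ ∑ z ∈ U, w z := Finset.sum_le_sum fun z _ => hw z
  have h5 : ∑ z ∈ U, netInflow f z = (∑ z ∈ U, ∑ y, f y z) - ∑ z ∈ U, ∑ x, f z x := by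
    unfold netInflow
    rw [Finset.sum_sub_distrib]
  linarith

/-! ### The first-slot density of `latticeE3` and the transport form of `C₃` -/

variable [DecidableEq α]

/-- The first-slot density of Sahi's functional: `latticeE3 μ U A B = Σ_{z∈U} μ z · density μ A B z` with
`density = 2Z²·1_{A∩B} + m(A)m(B) − Z·m(A∩B) − Z·m(A)·1_B − Z·m(B)·1_A`; for `Z = 1` it is `(1−a)+(1−b)−Cov` on `A ∩ B`
(capacity) and `−(b+Cov)`, `−(a+Cov)`, `−Cov` on `A∖B`, `B∖A`, `(A∪B)ᶜ` (supply), `Cov = m(A∩B) − m(A)m(B)`. [this work] -/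
def density (μ : α → ℝ) (A B : Finset α) (z : α) : ℝ :=
  2 * mass μ univ ^ 2 * (if z ∈ A ∩ B then 1 else 0) + mass μ A * mass μ B - mass μ univ * mass μ (A ∩ B)
    - mass μ univ * mass μ A * (if z ∈ B then 1 else 0) - mass μ univ * mass μ B * (if z ∈ A then 1 else 0)

omit [Fintype α] in
/-- `Σ_{z∈U} μ z · 1_S(z) = m(U ∩ S)`. [folklore] -/
private theorem sum_mul_ite_eq_mass (μ : α → ℝ) (U S : Finset α) :
    ∑ z ∈ U, μ z * (if z ∈ S then (1 : ℝ) else 0) = mass μ (U ∩ S) := by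
  simp only [mul_ite, mul_one, mul_zero]
  rw [Finset.sum_ite_mem]
  rfl

/-- **First-slot linearity**: `latticeE3 μ U A B = Σ_{z ∈ U} μ z · density μ A B z`. [this work] -/
theorem latticeE3_eq_sum_density (μ : α → ℝ) (U A B : Finset α) :
    latticeE3 μ U A B = ∑ z ∈ U, μ z * density μ A B z := by
  have hpt : ∀ z, μ z * density μ A B z =
      2 * mass μ univ ^ 2 * (μ z * (if z ∈ A ∩ B then 1 else 0))
        + (mass μ A * mass μ B - mass μ univ * mass μ (A ∩ B)) * μ z
        - mass μ univ * mass μ A * (μ z * (if z ∈ B then 1 else 0))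
        - mass μ univ * mass μ B * (μ z * (if z ∈ A then 1 else 0)) := by
    intro z; unfold density; ring
  rw [Finset.sum_congr rfl (fun z _ => hpt z), Finset.sum_sub_distrib, Finset.sum_sub_distrib, Finset.sum_add_distrib,
    ← Finset.mul_sum, ← Finset.mul_sum, ← Finset.mul_sum, ← Finset.mul_sum, sum_mul_ite_eq_mass, sum_mul_ite_eq_mass,
    sum_mul_ite_eq_mass]
  have hU : ∑ z ∈ U, μ z = mass μ U := rfl
  rw [hU, ← Finset.inter_assoc]
  unfold latticeE3
  ring

/-- **A `C₃`-flow for the pair `(A,B)`**: an upward flow whose net inflow at every point is at most `μ z · density μ A B z`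
— it delivers the supply `(b+Cov)μ|_{A∖B} + (a+Cov)μ|_{B∖A} + Cov·μ|_{(A∪B)ᶜ}` upward into `A ∩ B` within the capacity
`((1−a)+(1−b)−Cov)·μ|_{A∩B}` (normalised reading).  The monotone-coupling ("Strassen") form of `E₃(·, A, B) ≥ 0`. [this work] -/
def HasC3Flow [Preorder α] (μ : α → ℝ) (A B : Finset α) : Prop :=
  ∃ f : α → α → ℝ, IsUpFlow f ∧ ∀ z, netInflow f z ≤ μ z * density μ A B z

/-- **Transport form ⇒ `C₃` in the first slot**: a `C₃`-flow for `(A,B)` gives `latticeE3 μ U A B ≥ 0` for every up-set `U`.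
[this work] -/
theorem latticeE3_nonneg_of_hasC3Flow [Preorder α] {μ : α → ℝ} {A B : Finset α} (h : HasC3Flow μ A B)
    {U : Finset α} (hU : IsUpperSet (U : Set α)) : 0 ≤ latticeE3 μ U A B := by
  obtain ⟨f, hf, hdiv⟩ := h
  rw [latticeE3_eq_sum_density]
  exact sum_upperSet_nonneg_of_upFlow hf hdiv hU

/-- Flows for every pair of up-sets give Sahi's inequality `latticeE3 μ A B C ≥ 0` for every triple of up-sets
(only the flow for the pair `(B, C)` is used for the triple `(A, B, C)`). [this work] -/
theorem latticeE3_nonneg_of_forall_hasC3Flow [Preorder α] {μ : α → ℝ}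
    (h : ∀ B C : Finset α, IsUpperSet (B : Set α) → IsUpperSet (C : Set α) → HasC3Flow μ B C)
    {A B C : Finset α} (hA : IsUpperSet (A : Set α)) (hB : IsUpperSet (B : Set α)) (hC : IsUpperSet (C : Set α)) :
    0 ≤ latticeE3 μ A B C :=
  latticeE3_nonneg_of_hasC3Flow (h B C hB hC) hA

/-! ### The conjecture in transport form (statement only) -/

/-- **CONJECTURE (transport / monotone-coupling form of Sahi's `C₃`).**  For every nonnegative log-supermodular (FKG)
weight on a finite distributive lattice and every pair of up-sets there is a `C₃`-flow (`HasC3Flow`).  By Strassen /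
max-flow–min-cut on the finite poset this is EQUIVALENT to "`latticeE3 μ U A B ≥ 0` for all up-sets `U, A, B`", i.e. to
the indicator form of Sahi's Conjecture 5 at `n = 3` [Sahi2008, Conj. 5; LiebSahi2021, Conj. 1.1; Kahn2022, Conj. 5 for
product weights] — OPEN; the implication proved below is the direction a coupling proof would use.  An obligation /
hypothesis, never a fact.  Census: see the module docstring (`{0,1}^k`, `k ≤ 4`, product weights: a flow always exists,
and may be taken to insert the covariance mass at minimal elements only). [this work] [status: open] -/
@[conjecture] def C3FlowFormFKG : Prop :=
  ∀ (β : Type) [DistribLattice β] [Fintype β] [DecidableEq β] (μ : β → ℝ), 0 ≤ μ →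
    (∀ a b, μ a * μ b ≤ μ (a ⊓ b) * μ (a ⊔ b)) →
    ∀ A B : Finset β, IsUpperSet (A : Set β) → IsUpperSet (B : Set β) → HasC3Flow μ A B

/-- The transport form implies Sahi's `C₃` on indicators: `latticeE3 μ A B C ≥ 0` for all up-sets under every FKG weight
(`≤` on `Prop`: an implication between an open obligation and its consequence, not a proof of either). [this work] -/
theorem latticeE3_nonneg_of_c3FlowFormFKG (h : C3FlowFormFKG) (β : Type) [DistribLattice β] [Fintype β]
    [DecidableEq β] {μ : β → ℝ} (hμ₀ : 0 ≤ μ) (hμ : ∀ a b, μ a * μ b ≤ μ (a ⊓ b) * μ (a ⊔ b))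
    {A B C : Finset β} (hA : IsUpperSet (A : Set β)) (hB : IsUpperSet (B : Set β)) (hC : IsUpperSet (C : Set β)) :
    0 ≤ latticeE3 μ A B C :=
  latticeE3_nonneg_of_forall_hasC3Flow (fun B' C' hB' hC' => h β μ hμ₀ hμ B' C' hB' hC') hA hB hC

end Summit.CriticalPhenomena.PercolationContinuityZ3.Theorems.C3Transport
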